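import Literature.GroupTheory.CombinatorialGroupTheory.SurfaceGroupHeisenbergLift
import Mathlib.Algebra.Field.ZMod
import HarnessLib

/-!
# Lifting a pair of characters of a surface group to the extraspecial group of order `p³`
# ON THE KERNEL OF A NONTRIVIAL CHARACTER (no degree formula)

Topic `Literature/GroupTheory/CombinatorialGroupTheory`; companion of
`SurfaceGroupHeisenbergLift.lean` (abc-iut-L5-t17).  For the orientable surface group
`S_h = ⟨a₁, b₁, …, a_h, b_h ∣ ∏ᵢ [aᵢ, bᵢ]⟩` (`Literature.Topology.FourManifolds.SurfaceGroup h`), a prime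
`p`, a pair of characters `Φ = (Φ₁, Φ₂) : S_h → 𝔽_p × 𝔽_p` and a NONTRIVIAL character `χ : S_h → 𝔽_p`,
the restriction of `Φ` to `Ker χ` lifts to the extraspecial group `E ↠ 𝔽_p²` of order `p³`
(`exists_extraspecial_lift_ker`).  Classically: the obstruction is the cup product `Φ₁ ∪ Φ₂`, whose
restriction to the index-`p` subgroup `Ker χ` vanishes because an `n`-sheeted cover of closed oriented
surfaces has degree `n` (K. S. Brown, *Cohomology of Groups*, III (9.5)(ii) with the `PD²` fundamental
classes).  PROVED here WITHOUT any degree / transfer formula, by the following cohomology-free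
argument (theorems only, no definitions; the Heisenberg obstruction
`ω(Φ) = ∑ᵢ (Φ₁(aᵢ) Φ₂(bᵢ) - Φ₂(aᵢ) Φ₁(bᵢ))` is always written out):

* `SurfaceGroup.exists_character_omega_eq` — the pairing `(χ, μ) ↦ ω(χ, μ)` on `Hom(S_h, 𝔽_p)` is
  non-degenerate in the weak form needed: for `χ ≠ 1` and every `t ∈ 𝔽_p` there is `μ` with
  `ω(χ, μ) = t` (one nonzero generator value of `μ`, dual to a generator where `χ ≠ 0`);
* `exists_extraspecial_lift_ker` — with `t := ω(Φ)` and such a `μ`, the central extension `E_d` of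
  `V = (𝔽_p × 𝔽_p) × (𝔽_p × 𝔽_p)` by `𝔽_p` with bilinear cocycle `d(x, y) = x₁₁ y₂₁ - x₁₂ y₂₂` (the tree's
  `CocycleExtension`) receives a homomorphism `Θ : S_h → E_d` over `v = ((Φ₁, χ), (Φ₂, μ))`, because the
  surface relator goes to `ι(ω(Φ) - ω(χ, μ)) = ι(0) = 1`
  (`CocycleExtension.commutator_eq_inl_of_trivial`); writing `Θ s = (c s, v s)` one has
  `c(s s') = c s + c s' + Φ₁(s) Φ₂(s') - χ(s) μ(s')`, so ON `Ker χ` the map `s ↦ (c s, Φ s)` is a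
  homomorphism to the extraspecial extension `E_B`, `B(u, v) = u₁ v₂` — the required lift.  (In
  cohomological terms: `Φ₁ ∪ Φ₂ = χ ∪ μ` in `H²(S_h; 𝔽_p) ≅ 𝔽_p`, and `χ ∪ μ` visibly dies on `Ker χ`.)

Used by `Literature/IUT/HodgeTheaters/ProfiniteCompletionSurfaceBasisCharactersFcov.lean` to remove the
inline degree hypothesis `F_res` from the orientable-surface-group half of [IUTchI] Lemma 2.7 (v)
(`ProfiniteCompletionSurfaceBasisCharacters.lean`, abc-iut-L5-t17).
-/

noncomputable section

namespace Literature.GroupTheory.CombinatorialGroupTheory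

open Literature.Topology.FourManifolds Literature.Algebra.Homology Multiplicative groupCohomology

/-! ### Non-degeneracy of the Heisenberg pairing on characters -/

/-- **Non-degeneracy of the pairing `ω` on characters of `S_h`.**  If `χ : S_h → 𝔽_p` is a nontrivial
character, then for every `t ∈ 𝔽_p` there is a character `μ : S_h → 𝔽_p` with
`ω(χ, μ) = ∑ᵢ (χ(aᵢ) μ(bᵢ) - χ(bᵢ) μ(aᵢ)) = t`: if `χ(aᵢ) ≠ 0` take `μ(bᵢ) = t χ(aᵢ)⁻¹` and `μ = 0` on the
other generators, if `χ(bᵢ) ≠ 0` take `μ(aᵢ) = -t χ(bᵢ)⁻¹` (every assignment on generators extends,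
`SurfaceGroup.toCommGroup`).  This is the non-degeneracy of the cup-product (intersection) form on
`H¹(S_h; 𝔽_p)`. [cite: HatcherAT2002, §3.2 Example 3.7 (cup product on the orientable surface)] -/
theorem SurfaceGroup.exists_character_omega_eq (h p : ℕ) [Fact p.Prime]
    (χ : SurfaceGroup h →* Multiplicative (ZMod p)) (hχ : χ ≠ 1) (t : ZMod p) :
    ∃ μ : SurfaceGroup h →* Multiplicative (ZMod p),
      (∑ i : Fin h, (toAdd (χ (SurfaceGroup.a i)) * toAdd (μ (SurfaceGroup.b i)) -
        toAdd (χ (SurfaceGroup.b i)) * toAdd (μ (SurfaceGroup.a i)))) = t := by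
  classical
  -- some generator has nonzero `χ`-value
  obtain ⟨x₀, hx₀⟩ : ∃ x : surfaceGen h, toAdd (χ (PresentedGroup.of x)) ≠ 0 := by
    by_contra hall
    push Not at hall
    apply hχ
    refine PresentedGroup.ext fun x => ?_
    rw [MonoidHom.one_apply]
    exact toAdd_eq_zero.mp (hall x)
  obtain ⟨i, c⟩ := x₀
  -- the dual character: one nonzero value on the partner generator of `x₀ = (i, c)`
  let u : ZMod p := toAdd (χ (PresentedGroup.of (i, c)))
  have hu : u ≠ 0 := hx₀
  let val : surfaceGen h → ZMod p := fun x =>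
    if x = (i, !c) then (if c then -(t * u⁻¹) else t * u⁻¹) else 0
  let μ : SurfaceGroup h →* Multiplicative (ZMod p) := SurfaceGroup.toCommGroup fun x => ofAdd (val x)
  have hμ : ∀ x : surfaceGen h, toAdd (μ (PresentedGroup.of x)) = val x := fun x => by
    change toAdd (SurfaceGroup.toCommGroup (fun x => ofAdd (val x)) (PresentedGroup.of x)) = val x
    rw [SurfaceGroup.toCommGroup_of, toAdd_ofAdd]
  refine ⟨μ, ?_⟩
  -- only the `i`-th summand survives
  rw [Finset.sum_eq_single i]
  · change toAdd (χ (PresentedGroup.of (i, false))) * toAdd (μ (PresentedGroup.of (i, true))) -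
        toAdd (χ (PresentedGroup.of (i, true))) * toAdd (μ (PresentedGroup.of (i, false))) = t
    rw [hμ, hμ]
    cases c with
    | false =>
      have h1 : val (i, true) = t * u⁻¹ := by simp [val]
      have h2 : val (i, false) = 0 := by simp [val]
      rw [h1, h2, mul_zero, sub_zero]
      have hinv : u⁻¹ * u = 1 := inv_mul_cancel₀ (G₀ := ZMod p) hu
      change u * (t * u⁻¹) = t
      rw [mul_comm, mul_assoc, hinv, mul_one]
    | true =>
      have h1 : val (i, false) = -(t * u⁻¹) := by simp [val]
      have h2 : val (i, true) = 0 := by simp [val]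
      rw [h1, h2, mul_zero, zero_sub]
      have hinv : u⁻¹ * u = 1 := inv_mul_cancel₀ (G₀ := ZMod p) hu
      change -(u * -(t * u⁻¹)) = t
      rw [mul_neg, neg_neg, mul_comm, mul_assoc, hinv, mul_one]
  · intro j _ hji
    change toAdd (χ (PresentedGroup.of (j, false))) * toAdd (μ (PresentedGroup.of (j, true))) -
        toAdd (χ (PresentedGroup.of (j, true))) * toAdd (μ (PresentedGroup.of (j, false))) = 0
    rw [hμ, hμ]
    have h1 : val (j, true) = 0 := by
      simp only [val]
      rw [if_neg]
      intro hx
      exact hji (Prod.mk.inj hx).1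
    have h2 : val (j, false) = 0 := by
      simp only [val]
      rw [if_neg]
      intro hx
      exact hji (Prod.mk.inj hx).1
    rw [h1, h2, mul_zero, mul_zero, sub_zero]
  · intro hi
    exact absurd (Finset.mem_univ i) hi

/-! ### The extraspecial lift on the kernel of a nontrivial character -/

/-- **The extraspecial lift on the kernel of a character.**  For a prime `p` there are a finite group
`E` and a homomorphism `α : E → 𝔽_p × 𝔽_p` (the central extension of `𝔽_p²` by `𝔽_p` with bilinear
cocycle `B(u, v) = u₁ v₂`, an instance of the tree's `CocycleExtension`, exactly as in
`exists_extraspecial_lift`) such that (1) no lift of `(1, 0)` commutes with a lift of `(0, 1)`,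
(2) every `Φ : S_h → 𝔽_p × 𝔽_p` with vanishing Heisenberg obstruction `ω(Φ) = 0` lifts through `α` (as in
`exists_extraspecial_lift`, abc-iut-L5-t17, repeated here so that ONE `E` carries all three clauses), and
(3) for every genus `h`, every `Φ : S_h → 𝔽_p × 𝔽_p` and every NONTRIVIAL character `χ : S_h → 𝔽_p`,
the restriction of `Φ` to `Ker χ` lifts through `α`.  Proof of (3), with `ω` the Heisenberg
obstruction: choose `μ` with `ω(χ, μ) = ω(Φ)` (`SurfaceGroup.exists_character_omega_eq`); the surface
relator dies in the central extension `E_d` of `V = (𝔽_p × 𝔽_p)²` with cocycle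
`d(x, y) = x₁₁ y₂₁ - x₁₂ y₂₂` under `v = ((Φ₁, χ), (Φ₂, μ))` (its image is `ι(ω(Φ) - ω(χ, μ)) = 1`), giving
`Θ : S_h → E_d` over `v`; the first coordinate `c` of `Θ` satisfies
`c(s s') = c s + c s' + Φ₁(s) Φ₂(s') - χ(s) μ(s')`, whence `s ↦ (c s, Φ s)` is a homomorphism
`Ker χ → E_B`.  Classically (3) is "`res (Φ₁ ∪ Φ₂) = 0` on an index-`p` subgroup, the degree of a
`p`-sheeted cover being `p ≡ 0`" (Brown, *Cohomology of Groups*, III (9.5)(ii)); the present proof is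
"`Φ₁ ∪ Φ₂ = χ ∪ μ`, and `χ ∪ μ` dies on `Ker χ`", carried out on cocycles.
[cite: Brown1982CohomologyGroups, IV §3 (3.3)–(3.5)] -/
theorem exists_extraspecial_lift_ker (p : ℕ) [hp : Fact p.Prime] :
    ∃ (E : Type) (_ : Group E) (_ : Finite E)
      (α : E →* Multiplicative (ZMod p) × Multiplicative (ZMod p)),
      (∀ x y : E, α x = (ofAdd 1, 1) → α y = (1, ofAdd 1) → x * y ≠ y * x) ∧
      (∀ (h : ℕ) (Φ : SurfaceGroup h →* Multiplicative (ZMod p) × Multiplicative (ZMod p)),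
        (∑ i : Fin h, ((toAdd (Φ (SurfaceGroup.a i)).1) * (toAdd (Φ (SurfaceGroup.b i)).2) -
            (toAdd (Φ (SurfaceGroup.a i)).2) * (toAdd (Φ (SurfaceGroup.b i)).1))) = 0 →
        ∃ θ : SurfaceGroup h →* E, ∀ s, α (θ s) = Φ s) ∧
      ∀ (h : ℕ) (Φ : SurfaceGroup h →* Multiplicative (ZMod p) × Multiplicative (ZMod p))
        (χ : SurfaceGroup h →* Multiplicative (ZMod p)), χ ≠ 1 →
        ∃ θ : χ.ker →* E, ∀ s : χ.ker, α (θ s) = Φ (s : SurfaceGroup h) := by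
  classical
  haveI : NeZero p := ⟨hp.out.ne_zero⟩
  -- the bilinear cocycle `B(u, v) = u₁ v₂` on `𝔽_p × 𝔽_p` (as in `exists_extraspecial_lift`)
  let B : (ZMod p × ZMod p) →+ (ZMod p × ZMod p) →+ ZMod p :=
    { toFun := fun u =>
        { toFun := fun v => u.1 * v.2
          map_zero' := by simp
          map_add' := fun v v' => by simp only [Prod.snd_add, mul_add] }
      map_zero' := AddMonoidHom.ext fun v => by simp
      map_add' := fun u u' => AddMonoidHom.ext fun v => by
        simp only [AddMonoidHom.coe_mk, ZeroHom.coe_mk, AddMonoidHom.add_apply, Prod.fst_add, add_mul] }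
  have hB : ∀ u v : ZMod p × ZMod p, B u v = u.1 * v.2 := fun u v => rfl
  obtain ⟨f, hf⟩ := exists_cocycles₂_of_biadditive B
  haveI : Finite (Rep.trivial (ZMod p) (Multiplicative (ZMod p × ZMod p)) (ZMod p)) :=
    inferInstanceAs (Finite (ZMod p))
  let cf : Multiplicative (ZMod p × ZMod p) →* Multiplicative (ZMod p) × Multiplicative (ZMod p) :=
    ((AddMonoidHom.fst (ZMod p) (ZMod p)).toMultiplicative).prod
      ((AddMonoidHom.snd (ZMod p) (ZMod p)).toMultiplicative)
  let α : CocycleExtension f →* Multiplicative (ZMod p) × Multiplicative (ZMod p) :=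
    cf.comp (CocycleExtension.rightHom f)
  have hα : ∀ x : CocycleExtension f, α x = (ofAdd (toAdd x.right).1, ofAdd (toAdd x.right).2) :=
    fun x => rfl
  have hcomm : ∀ x y : CocycleExtension f, x * y * x⁻¹ * y⁻¹ =
      CocycleExtension.inl f (ofAdd ((toAdd x.right).1 * (toAdd y.right).2 -
        (toAdd y.right).1 * (toAdd x.right).2)) := fun x y => by
    rw [CocycleExtension.commutator_eq_inl_of_trivial f x y (Commute.all _ _), hf, hf, hB, hB]
  refine ⟨CocycleExtension f, inferInstance, inferInstance, α, ?_, ?_, ?_⟩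
  · -- (1) no commuting lifts of the basis (verbatim as in `exists_extraspecial_lift`)
    intro x y hx hy hxy
    rw [hα, Prod.mk.injEq] at hx hy
    have hx1 : (toAdd x.right).1 = 1 := by simpa using congrArg toAdd hx.1
    have hx2 : (toAdd x.right).2 = 0 := by simpa using congrArg toAdd hx.2
    have hy1 : (toAdd y.right).1 = 0 := by simpa using congrArg toAdd hy.1
    have hy2 : (toAdd y.right).2 = 1 := by simpa using congrArg toAdd hy.2
    have hc := hcomm x y
    rw [hx1, hx2, hy1, hy2, mul_one, mul_zero, sub_zero, hxy, mul_inv_cancel_right,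
      mul_inv_cancel] at hc
    have h1 : CocycleExtension.inl f (ofAdd (1 : ZMod p)) = CocycleExtension.inl f 1 := by
      rw [(CocycleExtension.inl f).map_one]; exact hc.symm
    have h2 := CocycleExtension.inl_injective f h1
    rw [ofAdd_eq_one] at h2
    exact one_ne_zero h2
  · -- (2) lifting when `ω(Φ) = 0` (abc-iut-L5-t17's argument, `exists_extraspecial_lift`)
    intro h Φ hω
    let F : surfaceGen h → CocycleExtension f := fun x =>
      ⟨0, ofAdd (toAdd (Φ (PresentedGroup.of x)).1, toAdd (Φ (PresentedGroup.of x)).2)⟩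
    have hFr : ∀ x, (F x).right =
        ofAdd (toAdd (Φ (PresentedGroup.of x)).1, toAdd (Φ (PresentedGroup.of x)).2) := fun x => rfl
    have hrel : ∀ r ∈ ({surfaceRelator h} : Set (FreeGroup (surfaceGen h))),
        FreeGroup.lift F r = 1 := by
      intro r hr
      rw [Set.mem_singleton_iff] at hr
      subst hr
      rw [surfaceRelator, map_list_prod, List.map_map]
      let c : Fin h → ZMod p := fun i =>
        (toAdd (Φ (PresentedGroup.of (i, false))).1) * (toAdd (Φ (PresentedGroup.of (i, true))).2) -
          (toAdd (Φ (PresentedGroup.of (i, false))).2) * (toAdd (Φ (PresentedGroup.of (i, true))).1)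
      have hterm : ∀ i : Fin h,
          (FreeGroup.lift F ∘ fun i => genA i * genB i * (genA i)⁻¹ * (genB i)⁻¹) i =
            CocycleExtension.inl f (ofAdd (c i)) := by
        intro i
        simp only [Function.comp_apply, map_mul, map_inv, genA, genB, FreeGroup.lift_apply_of]
        rw [hcomm, hFr, hFr, toAdd_ofAdd, toAdd_ofAdd]
        change _ = CocycleExtension.inl f (ofAdd
          ((toAdd (Φ (PresentedGroup.of (i, false))).1) * (toAdd (Φ (PresentedGroup.of (i, true))).2) -
          (toAdd (Φ (PresentedGroup.of (i, false))).2) * (toAdd (Φ (PresentedGroup.of (i, true))).1)))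
        rw [mul_comm (toAdd (Φ (PresentedGroup.of (i, true))).1)]
      have hlist : ∀ (L : List (Fin h)),
          (L.map fun i => CocycleExtension.inl f (ofAdd (c i))).prod =
            CocycleExtension.inl f (ofAdd (L.map c).sum) := by
        intro L
        induction L with
        | nil => rw [List.map_nil, List.prod_nil, List.map_nil, List.sum_nil, ofAdd_zero, map_one]
        | cons x L ih =>
          rw [List.map_cons, List.prod_cons, List.map_cons, List.sum_cons, ofAdd_add, map_mul, ih]
      have hω' : ((List.finRange h).map c).sum = 0 := by
        rw [← Fin.sum_univ_def]
        simpa only [SurfaceGroup.a, SurfaceGroup.b] using hω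
      rw [List.map_congr_left (fun i _ => hterm i), hlist, hω', ofAdd_zero, map_one]
    refine ⟨PresentedGroup.toGroup hrel, fun s => ?_⟩
    have hgen : ∀ x : surfaceGen h,
        α (PresentedGroup.toGroup hrel (PresentedGroup.of x)) = Φ (PresentedGroup.of x) := by
      intro x
      rw [PresentedGroup.toGroup.of, hα, hFr, toAdd_ofAdd]
      change (ofAdd (toAdd (Φ (PresentedGroup.of x)).1), ofAdd (toAdd (Φ (PresentedGroup.of x)).2)) = _
      rw [ofAdd_toAdd, ofAdd_toAdd]
    exact DFunLike.congr_fun (PresentedGroup.ext (φ := α.comp (PresentedGroup.toGroup hrel))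
      (ψ := Φ) hgen) s
  · -- (3) lifting on `Ker χ`
    intro h Φ χ hχ
    -- shorthand for the coordinates of `Φ`, `χ` and the Heisenberg obstruction `t = ω(Φ)`
    let Φ₁ : SurfaceGroup h → ZMod p := fun s => (toAdd (Φ s).1)
    let Φ₂ : SurfaceGroup h → ZMod p := fun s => (toAdd (Φ s).2)
    have hΦ₁ : ∀ s s', Φ₁ (s * s') = Φ₁ s + Φ₁ s' := fun s s' => by
      simp only [Φ₁, map_mul, Prod.fst_mul, toAdd_mul]
    have hΦ₂ : ∀ s s', Φ₂ (s * s') = Φ₂ s + Φ₂ s' := fun s s' => by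
      simp only [Φ₂, map_mul, Prod.snd_mul, toAdd_mul]
    let t : ZMod p := ∑ i : Fin h, (Φ₁ (SurfaceGroup.a i) * Φ₂ (SurfaceGroup.b i) -
      Φ₂ (SurfaceGroup.a i) * Φ₁ (SurfaceGroup.b i))
    -- the dual character `μ` with `ω(χ, μ) = t`
    obtain ⟨μ, hμ⟩ := SurfaceGroup.exists_character_omega_eq h p χ hχ t
    let χ' : SurfaceGroup h → ZMod p := fun s => toAdd (χ s)
    let μ' : SurfaceGroup h → ZMod p := fun s => toAdd (μ s)
    have hχ' : ∀ s s', χ' (s * s') = χ' s + χ' s' := fun s s' => by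
      simp only [χ', map_mul, toAdd_mul]
    have hμ' : ∀ s s', μ' (s * s') = μ' s + μ' s' := fun s s' => by
      simp only [μ', map_mul, toAdd_mul]
    -- the cocycle `d(x, y) = x₁₁ y₂₁ - x₁₂ y₂₂` on `V = (𝔽_p × 𝔽_p) × (𝔽_p × 𝔽_p)`
    let D : ((ZMod p × ZMod p) × (ZMod p × ZMod p)) →+
        ((ZMod p × ZMod p) × (ZMod p × ZMod p)) →+ ZMod p :=
      { toFun := fun x =>
          { toFun := fun y => x.1.1 * y.2.1 - x.1.2 * y.2.2
            map_zero' := by simp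
            map_add' := fun y y' => by
              simp only [Prod.fst_add, Prod.snd_add]
              ring }
        map_zero' := AddMonoidHom.ext fun y => by simp
        map_add' := fun x x' => AddMonoidHom.ext fun y => by
          simp only [AddMonoidHom.coe_mk, ZeroHom.coe_mk, AddMonoidHom.add_apply, Prod.fst_add,
            Prod.snd_add]
          ring }
    have hD : ∀ x y : (ZMod p × ZMod p) × (ZMod p × ZMod p),
        D x y = x.1.1 * y.2.1 - x.1.2 * y.2.2 := fun x y => rfl
    obtain ⟨d, hd⟩ := exists_cocycles₂_of_biadditive D
    -- the homomorphism `v = ((Φ₁, χ), (Φ₂, μ)) : S_h → V`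
    let v : SurfaceGroup h →* Multiplicative ((ZMod p × ZMod p) × (ZMod p × ZMod p)) :=
      { toFun := fun s => ofAdd ((Φ₁ s, χ' s), (Φ₂ s, μ' s))
        map_one' := by
          simp only [Φ₁, Φ₂, χ', μ', map_one, Prod.fst_one, Prod.snd_one, toAdd_one]
          rfl
        map_mul' := fun s s' => by
          rw [← ofAdd_add, hΦ₁, hΦ₂, hχ', hμ']
          rfl }
    have hv : ∀ s, toAdd (v s) = ((Φ₁ s, χ' s), (Φ₂ s, μ' s)) := fun s => rfl
    -- commutators in `E_d`
    have hcommd : ∀ x y : CocycleExtension d, x * y * x⁻¹ * y⁻¹ =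
        CocycleExtension.inl d (ofAdd
          (((toAdd x.right).1.1 * (toAdd y.right).2.1 - (toAdd x.right).1.2 * (toAdd y.right).2.2) -
           ((toAdd y.right).1.1 * (toAdd x.right).2.1 - (toAdd y.right).1.2 * (toAdd x.right).2.2))) :=
      fun x y => by
      rw [CocycleExtension.commutator_eq_inl_of_trivial d x y (Commute.all _ _), hd, hd, hD, hD]
    -- the candidate images of the generators in `E_d`
    let F : surfaceGen h → CocycleExtension d := fun x => ⟨0, v (PresentedGroup.of x)⟩
    have hFr : ∀ x, (F x).right = v (PresentedGroup.of x) := fun x => rfl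
    -- the relator goes to `ι(ω(Φ) - ω(χ, μ)) = ι(0) = 1`
    have hrel : ∀ r ∈ ({surfaceRelator h} : Set (FreeGroup (surfaceGen h))),
        FreeGroup.lift F r = 1 := by
      intro r hr
      rw [Set.mem_singleton_iff] at hr
      subst hr
      rw [surfaceRelator, map_list_prod, List.map_map]
      let e : Fin h → ZMod p := fun i =>
        (Φ₁ (SurfaceGroup.a i) * Φ₂ (SurfaceGroup.b i) - χ' (SurfaceGroup.a i) * μ' (SurfaceGroup.b i)) -
          (Φ₁ (SurfaceGroup.b i) * Φ₂ (SurfaceGroup.a i) - χ' (SurfaceGroup.b i) * μ' (SurfaceGroup.a i))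
      have hterm : ∀ i : Fin h,
          (FreeGroup.lift F ∘ fun i => genA i * genB i * (genA i)⁻¹ * (genB i)⁻¹) i =
            CocycleExtension.inl d (ofAdd (e i)) := by
        intro i
        simp only [Function.comp_apply, map_mul, map_inv, genA, genB, FreeGroup.lift_apply_of]
        rw [hcommd, hFr, hFr, hv, hv]
        rfl
      have hlist : ∀ (L : List (Fin h)),
          (L.map fun i => CocycleExtension.inl d (ofAdd (e i))).prod =
            CocycleExtension.inl d (ofAdd (L.map e).sum) := by
        intro L
        induction L with
        | nil => rw [List.map_nil, List.prod_nil, List.map_nil, List.sum_nil, ofAdd_zero, map_one]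
        | cons x L ih =>
          rw [List.map_cons, List.prod_cons, List.map_cons, List.sum_cons, ofAdd_add, map_mul, ih]
      have hsum : ((List.finRange h).map e).sum = 0 := by
        rw [← Fin.sum_univ_def]
        have he : ∀ i : Fin h, e i =
            (Φ₁ (SurfaceGroup.a i) * Φ₂ (SurfaceGroup.b i) - Φ₂ (SurfaceGroup.a i) * Φ₁ (SurfaceGroup.b i)) -
            (χ' (SurfaceGroup.a i) * μ' (SurfaceGroup.b i) - χ' (SurfaceGroup.b i) * μ' (SurfaceGroup.a i)) :=
          fun i => by simp only [e]; ring
        rw [Finset.sum_congr rfl (fun i _ => he i), Finset.sum_sub_distrib]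
        change t - (∑ i : Fin h, (toAdd (χ (SurfaceGroup.a i)) * toAdd (μ (SurfaceGroup.b i)) -
          toAdd (χ (SurfaceGroup.b i)) * toAdd (μ (SurfaceGroup.a i)))) = 0
        rw [hμ, sub_self]
      rw [List.map_congr_left (fun i _ => hterm i), hlist, hsum, ofAdd_zero, map_one]
    -- `Θ : S_h → E_d` over `v`
    let Θ : SurfaceGroup h →* CocycleExtension d := PresentedGroup.toGroup hrel
    have hΘr : ∀ s, (Θ s).right = v s := by
      intro s
      have hgen : ∀ x : surfaceGen h,
          (CocycleExtension.rightHom d).comp Θ (PresentedGroup.of x) = v (PresentedGroup.of x) := by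
        intro x
        rw [MonoidHom.comp_apply]
        change (PresentedGroup.toGroup hrel (PresentedGroup.of x)).right = _
        rw [PresentedGroup.toGroup.of]
      exact DFunLike.congr_fun (PresentedGroup.ext (φ := (CocycleExtension.rightHom d).comp Θ)
        (ψ := v) hgen) s
    -- the first coordinate `c` of `Θ` and its twisted additivity
    let c : SurfaceGroup h → ZMod p := fun s => (Θ s).left
    have hc : ∀ s s', c (s * s') = c s + c s' + (Φ₁ s * Φ₂ s' - χ' s * μ' s') := by
      intro s s'
      have hmul := congrArg CocycleExtension.left (Θ.map_mul s s')
      rw [CocycleExtension.mul_left, hΘr, hΘr, hd, hD, hv, hv] at hmul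
      simp only [Representation.trivial_apply] at hmul
      exact hmul
    -- on `Ker χ` the `χ μ`-term vanishes: `s ↦ (c s, Φ s)` is a homomorphism to `E_B`
    have hker : ∀ s : χ.ker, χ' (s : SurfaceGroup h) = 0 := fun s => by
      have := s.2
      rw [MonoidHom.mem_ker] at this
      simp only [χ', this, toAdd_one]
    let θ : χ.ker →* CocycleExtension f :=
      MonoidHom.mk' (fun s => (⟨c s, ofAdd (Φ₁ s, Φ₂ s)⟩ : CocycleExtension f)) fun s s' => by
        refine CocycleExtension.ext ?_ ?_
        · rw [CocycleExtension.mul_left, hf, hB]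
          simp only [Representation.trivial_apply, toAdd_ofAdd]
          change c ((s : SurfaceGroup h) * s') = c s + c s' + Φ₁ s * Φ₂ s'
          rw [hc, hker s, zero_mul, sub_zero]
        · rw [CocycleExtension.mul_right]
          change ofAdd (Φ₁ ((s : SurfaceGroup h) * s'), Φ₂ ((s : SurfaceGroup h) * s')) =
            ofAdd (Φ₁ s, Φ₂ s) * ofAdd (Φ₁ s', Φ₂ s')
          rw [← ofAdd_add, hΦ₁, hΦ₂]
          rfl
    refine ⟨θ, fun s => ?_⟩
    rw [hα]
    change (ofAdd (toAdd (ofAdd (Φ₁ s, Φ₂ s))).1, ofAdd (toAdd (ofAdd (Φ₁ s, Φ₂ s))).2) = Φ s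
    rw [toAdd_ofAdd]
    change (ofAdd (toAdd (Φ s).1), ofAdd (toAdd (Φ s).2)) = Φ s
    rw [ofAdd_toAdd, ofAdd_toAdd]

end Literature.GroupTheory.CombinatorialGroupTheory

end
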